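import Mathlib
import Summits.Ventures.HodgeRepro2.T5QuadraticAutomorphism

/-!
# A separable quadratic extension is Galois and HAS a non-trivial automorphism

`F ⊆ E` fields with `[E : F] = 2` and `E/F` separable (automatic in characteristic `0`, e.g. for
Mathlib's completions of number fields).  Every `x ∈ E` has a minimal polynomial of degree `≤ 2`
with the root `x`, so it splits in `E` (`(X − x) · (linear)`): `E/F` is NORMAL, hence Galois;
`|Aut(E/F)| = [E : F] = 2`, so a non-trivial automorphism exists — the `σ ≠ 1` hypothesis of
`T5QuadraticAutomorphism` / `T5QuadraticBasis` and of the completion files is DISCHARGED.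

Declaration per README §8(d): «uses an L-value-free non-vanishing device: NO».
-/

namespace Summit.Ventures.HodgeRepro2.T5QuadraticGalois

open Polynomial

variable {F E : Type*} [Field F] [Field E] [Algebra F E] [FiniteDimensional F E]

/-- A polynomial of degree `≤ 2` with a root splits. -/
theorem splits_of_natDegree_le_two_of_isRoot {p : E[X]} (hp : p.natDegree ≤ 2) {x : E}
    (hx : p.IsRoot x) : p.Splits := by
  rw [← mul_divByMonic_eq_iff_isRoot.2 hx]
  refine Splits.mul (Polynomial.Splits.X_sub_C x) (Splits.of_natDegree_le_one ?_)
  rw [natDegree_divByMonic _ (monic_X_sub_C x), natDegree_X_sub_C]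
  omega

/-- `[E : F] = 2` ⇒ `E/F` is normal. -/
theorem normal (h2 : Module.finrank F E = 2) : Normal F E := by
  rw [normal_iff]
  intro x
  refine ⟨Algebra.IsIntegral.isIntegral x, ?_⟩
  apply splits_of_natDegree_le_two_of_isRoot
  · rw [natDegree_map]
    exact (minpoly.natDegree_le x).trans h2.le
  · rw [IsRoot.def, eval_map, ← aeval_def]
    exact minpoly.aeval F x

/-- `[E : F] = 2`, `E/F` separable ⇒ Galois. -/
theorem isGalois [Algebra.IsSeparable F E] (h2 : Module.finrank F E = 2) : IsGalois F E :=
  haveI := normal h2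
  IsGalois.mk

/-- `|Aut(E/F)| = 2`. -/
theorem card_aut_eq_two [Algebra.IsSeparable F E] (h2 : Module.finrank F E = 2) :
    Nat.card (E ≃ₐ[F] E) = 2 := by
  haveI := isGalois h2
  rw [IsGalois.card_aut_eq_finrank, h2]

/-- A NON-TRIVIAL automorphism exists. -/
theorem exists_ne_one [Algebra.IsSeparable F E] (h2 : Module.finrank F E = 2) :
    ∃ σ : E ≃ₐ[F] E, σ ≠ 1 := by
  obtain ⟨σ, hσ, -⟩ := (Nat.card_eq_two_iff' (1 : E ≃ₐ[F] E)).1 (card_aut_eq_two h2)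
  exact ⟨σ, hσ⟩

/-- Packaging with `T5QuadraticAutomorphism`: a separable quadratic extension has an involution
whose fixed elements are exactly the base. -/
theorem exists_involution [Algebra.IsSeparable F E] (h2 : Module.finrank F E = 2) :
    ∃ σ : E ≃ₐ[F] E, σ ≠ 1 ∧ (∀ a, σ (σ a) = a) ∧
      ∀ z, σ z = z → z ∈ Set.range (algebraMap F E) := by
  obtain ⟨σ, hσ⟩ := exists_ne_one h2
  exact ⟨σ, hσ, T5QuadraticAutomorphism.apply_apply h2 σ hσ,
    fun _ hz => T5QuadraticAutomorphism.mem_range_of_fixed h2 σ hσ hz⟩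

end Summit.Ventures.HodgeRepro2.T5QuadraticGalois
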